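import Literature.NumberTheory.LFunctions.Zhang2022.RepairVerdictAssembly
import Literature.NumberTheory.LFunctions.Zhang2022.KnifeEdgeOverhangRankOne
import Literature.NumberTheory.LFunctions.Zhang2022.KnifeEdgeDiscMeanFlat

/-!
# Zhang (2022) §18-margin repair rung — THE FIRST BARRIER EXTENSION: NOT-REPAIRABLE-IN-CLASS `R⁺`
# (`R⁺ = R ∪ R̄ ∪ {smooth top-vanishing pieces of any length}`), one kernel theorem `not_repairable_in_Rplus`

Trunk T-ANT (NumberTheory/LFunctions). Y. Zhang, *Discrete mean estimates and the Landau–Siegel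
zero*, arXiv:2211.02515v1 (2022) [Zhang2022LandauSiegel] — **an unrefereed manuscript under
adjudication. WHAT THIS IS NOT: nothing here asserts or denies its Theorems 1–2 or any analytic lemma;
no claim about Landau–Siegel zeros, about Parity, or about a repaired `Margin232` is made. The theorem
below is about the manuscript's METHOD AS ARCHITECTED — the class `R⁺` of mollifier / profile designs fed
to the SAME main-term calculus — not about zeros of `L`-functions.** Cell `landau-siegel` (rung F-S3),
sub-cell E (barrier extension), charter LS-PROGRAMME v1.1 §2 row E: «class `R⁺ = R ∪`
smooth-top-vanishing-any-length, assembling p442741 + p446527 + p428635 into ONE `not_repairable_in_Rplus`»;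
class text of record = OBJECTIVE.md v1.1 §1.3 (rows `R`, `R̄`, `R⁺ \ R̄`).

## The class `R⁺` and its four currencies

A design of class `R⁺` (`DesignPlus`, membership `InRplus`) is one of

* `inR θ` — a parametrised design `θ = (ν₁,ν₂,ν₃; k₁,k₂,k₃; ι₂,ι₃,ι₄; cut₁)` of CLASS `R`
  (`Repair.AdmissibleTheta θ`, p421602); verdict currency T-true: `¬ (C₂₃₂(θ)·C₂₃₃(θ) < |𝔡+𝔡′|²(θ))`
  — this part IS `Repair.not_repairable_true_need` (p428635), so `R ⊆ R⁺` literally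
  (`inRplus_of_admissible`, `not_repairable_in_Rplus_inR`);
* `hOne g g′ f f′` — CLASS `R̄`: any pair of `H¹` profiles on `[0,1]` (any number of pieces, any lengths
  `≤ P`, any probe — a finite sum of `H¹` pieces is `H¹`); currency T-true at profile level:
  `¬ (𝔅(g)·𝔅(f) < ‖P(g,f)‖²)` (Cauchy–Schwarz for the ONE positive semidefinite main-term form `𝔅`,
  `not_trueNeed_of_isH1`);
* `twoPiece θ u u′ v v′ s` — CLASS `R⁺ \ R̄` in the `X`-WORLD currency of p442741: an in-class piece `u`
  (`KnifeEdge.InClassPiece`: kinked `H¹` on `[0,1]`, `= 0` on `[1,∞)`) glued at the wall `z = 1` WITHOUT JUMP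
  to an overhang piece `v` on `[1,θ]`, `θ ≥ 1` (`KnifeEdge.OverhangPiece θ v v′`: continuous on `[0,θ]`,
  `= 0` on `(−∞,1]`, right derivative `v′ ∈ L²(1,θ)` on `[1,θ)`, top-vanishing `v(θ) = 0`), relative weight
  `s ∈ ℂ` (the design `s·u ⊕ v`). DECLARED NARROWING w.r.t. the class text «`v` 1-Lipschitz, `‖v‖∞ ≤ 1`»:
  `OverhangPiece` asks a right derivative in `L²(1,θ)` instead (needed to even write the continued
  diagonal form `Repair.topDiagForm θ v v′` inside `KnifeEdge.twoPieceMainTerm`); the Lipschitz class itself,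
  with NO differentiability, is covered in the fourth currency. Verdict: **for every off-diagonal world
  `X : KnifeEdge.PairFunctional` satisfying the DISPLAYED E*-slot `KnifeEdge.InvisibleOverhang θ X`
  (a bare `Prop`, NOT asserted; its negation is the E*-len⁺(X)-strength input, registry E-002), the
  two-piece main-order constant is not negative: `¬ (twoPieceMainTerm θ X u u′ v v′ s < 0)`**
  (`KnifeEdge.null_of_invisible`, p442741) — «closing in `R⁺ \ R̄` needs `¬ InvisibleOverhang`»;
* `farPiece c′ δ ε g` — CLASS `R⁺ \ R̄` in the DISCRETE-MEAN currency of p446527, the charter's regularity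
  verbatim: a profile `g` that is 1-Lipschitz with `‖g‖∞ ≤ 1` (`tailInvisible`'s class, p446031), used as
  the smooth coefficient `χψ(n)·g(log n/log P)·n^{−ρ}` up to ANY length `P^{1+δ}`, `0 < ε < δ`, any shift
  parameter `c′`. Verdict, with the (A)-world hypothesis of record DISPLAYED (`Re ρ = ½` for every sampled
  zero — Prop. 2.2's output under (A); nothing here asserts it): for all large `D` and every real primitive
  `χ (mod D)`, **pushing the length from `P^{1+ε}` to `P^{1+δ}` gains nothing at main order** —
  `¬ (P^{−ε/8}·(discMeanAbs + discWeight) < |discMean(⌈P^{1+δ}⌉) − discMean(⌈P^{1+ε}⌉)|)`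
  (`KnifeEdgeDiscMeanFlat.discMeanFlat`, p446527, from `KnifeEdgeInvisibleTail.tailInvisible`, p446031:
  complete character sums to modulus `pD`, Pólya–Vinogradov × Abel). The three bookkeeping `def`s
  `discMean`/`discMeanAbs`/`discWeight` below are the literal sub-expressions of `discMeanFlat`.

**`not_repairable_in_Rplus : ∀ d, InRplus d → NoMainOrderClosing d`** is proved by cases from exactly
these inputs; no numerics, no new `Prop` facts, standard axioms. Unbundled forms with every hypothesis as a
literal binder: `not_repairable_in_Rplus_inR`, `_hOne`, `_twoPiece`, `_farPiece`, and
`not_closesByPositivity_in_Rplus` (`¬ KnifeEdge.ClosesByPositivity θ X` on every invisible `X`-world).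
Non-vacuity of the class: `inRplus_theta0` (the printed point), `inRplus_thetaIota`, `inRplus_gStar_phiT`
(`g⋆ ⊕ φ_θ`, every `θ ≥ 1`, e.g. `θ = 21/20`, `θ = 5/2`), `inRplus_hOne_gStar`, `inRplus_flatProfile`.

What is NOT in `R⁺` (OBJECTIVE §1.3 (O1)–(O5); = the targets of the next extensions `R⁺⁺`, one per family
killed by §B, each a new `DesignFamily` below): the band-width bookkeeping `z ∈ (1, 1+ε]` between the two
currencies of `R⁺ \ R̄` (`DiscMeanUpperWidth`-type statement, registry E-004), pieces with a jump at the wall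
(`g(1) ≠ 0` cross term, E-005/E-006), lengths `≥ P` with general coefficients and only in-print off-diagonal
input (E-001/E-002), the parameter box beyond `R` (`ν₂ > ½`, untied `k₃`), other zero-detectors with the same
main-term calculus (E-015), the `ℓ`-lever (E-007).

## Extension protocol (`R⁺ ⊆ R⁺⁺ ⊆ …`)

`DesignFamily` packages one currency: a design type, its class predicate and its verdict shape;
`DesignFamily.Decided F := ∀ d, F.InClass d → F.Verdict d`; a class is a `List DesignFamily` and
`ClassDecided` is `Decided` of every member (`classDecided_cons`, `classDecided_append`). `Rplus` is the list of
the four families above and `rplus_decided : ClassDecided Rplus` is `not_repairable_in_Rplus` re-packaged; an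
extension is `Rplus ++ [F]` together with ONE new theorem `F.Decided` — nothing already decided is re-proved.

## References

* Y. Zhang, arXiv:2211.02515v1 (2022), §2 Props. 2.2, 2.4–2.6, (2.15)–(2.20), (2.32)–(2.33) [p. 4–11],
  §7 Prop. 7.1, (7.2) [p. 44], §8 Lemma 8.1, (8.11)–(8.12), §10 (10.1), (10.17), §18 [p. 99–101].
  [cite: Zhang2022LandauSiegel, §§2, 7, 8, 10, 18]
-/

noncomputable section

open Real Complex ComplexConjugate

namespace Literature.NumberTheory.LFunctions.Zhang2022

namespace Repair

open KnifeEdge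

/-! ### The discrete-mean vocabulary (literal sub-expressions of `KnifeEdgeDiscMeanFlat.discMeanFlat`) -/

section DiscMean

variable {D : ℕ} [NeZero D]

/-- The smooth profile polynomial of length `N`: `F_g(N; ψ, s) = Σ_{1 ≤ n < N} χψ(n)·g(log n/log P)·n^{−s}`.
[cite: Zhang2022LandauSiegel, §2 (2.23); §7 (7.2) p.44] -/
def profPoly (χ : DirichletCharacter ℂ D) (x : Skeleton.Chr D) (g : ℝ → ℂ) (N : ℕ) (s : ℂ) : ℂ :=
  ∑ n ∈ Finset.Ico 1 N, Skeleton.pc χ x n * g (Real.log n / Real.log (Skeleton.bigP D)) * (n : ℂ) ^ (-s)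

/-- The discrete mean of `|F_g(N)|²` over the sampled zeros: `Σ_{(ψ,ρ) ∈ idx χ} Re 𝔠*(ρ,ψ)·|F_g(N;ψ,ρ)|²·Re ω(ρ)`
(the shape of (2.16)–(2.20) with one squared polynomial). [cite: Zhang2022LandauSiegel, §2 (2.16)–(2.20)] -/
def discMean (c' : ℝ) (χ : DirichletCharacter ℂ D) (g : ℝ → ℂ) (N : ℕ) : ℝ :=
  ∑ i ∈ Skeleton.idx χ, (Skeleton.cstar c' D i.1 i.2).re * ‖profPoly χ i.1 g N i.2‖ ^ 2 *
    (Skeleton.omegaW D i.2).re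

/-- The same sum with absolute weights `|Re 𝔠* · Re ω|`. [cite: Zhang2022LandauSiegel, §2 (2.16)–(2.20)] -/
def discMeanAbs (c' : ℝ) (χ : DirichletCharacter ℂ D) (g : ℝ → ℂ) (N : ℕ) : ℝ :=
  ∑ i ∈ Skeleton.idx χ, |(Skeleton.cstar c' D i.1 i.2).re * (Skeleton.omegaW D i.2).re| *
    ‖profPoly χ i.1 g N i.2‖ ^ 2

/-- The total absolute weight `Σ |Re 𝔠*(ρ,ψ) · Re ω(ρ)|`. [cite: Zhang2022LandauSiegel, §2 (2.15)–(2.16)] -/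
def discWeight (c' : ℝ) (χ : DirichletCharacter ℂ D) : ℝ :=
  ∑ i ∈ Skeleton.idx χ, |(Skeleton.cstar c' D i.1 i.2).re * (Skeleton.omegaW D i.2).re|

end DiscMean

/-! ### The class `R⁺`: designs, membership, verdict shape -/

/-- **Designs of class `R⁺`** — four presentations, one per currency of the record: a class-`R` parameter
vector `θ`; a pair of `H¹` profiles (`R̄`); a smooth two-piece design `s·u ⊕ v` across the wall `P` (length
`θ ≥ 1`, `X`-world currency); a smooth profile `g` of any length `P^{1+δ}` (discrete-mean currency, shift `c′`,
comparison length `P^{1+ε}`). [cite: Zhang2022LandauSiegel, §2 (2.32)–(2.33); §7 (7.2) p.44] -/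
inductive DesignPlus : Type
  | inR (θ : Theta)
  | hOne (g g' f f' : ℝ → ℂ)
  | twoPiece (θ : ℝ) (u u' v v' : ℝ → ℂ) (s : ℂ)
  | farPiece (c' δ ε : ℝ) (g : ℝ → ℂ)

/-- **Membership in `R⁺`** (class predicate; NO analytic hypothesis is folded in here): `AdmissibleTheta θ` |
both profiles `H¹` on `[0,1]` | `1 ≤ θ`, `InClassPiece u u′`, `OverhangPiece θ v v′` (declared narrowing:
right derivative in `L²(1,θ)`) | `0 < ε < δ`, `g` 1-Lipschitz, `‖g‖∞ ≤ 1`.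
[cite: Zhang2022LandauSiegel, §2 (2.32)–(2.33); §7 (7.2) p.44] -/
def InRplus : DesignPlus → Prop
  | .inR θ => AdmissibleTheta θ
  | .hOne g g' f f' => IsH1OnUnitInterval g g' ∧ IsH1OnUnitInterval f f'
  | .twoPiece θ u u' v v' _ => 1 ≤ θ ∧ InClassPiece u u' ∧ OverhangPiece θ v v'
  | .farPiece _ δ ε g => 0 < ε ∧ ε < δ ∧ LipschitzWith 1 g ∧ ∀ z, ‖g z‖ ≤ 1

/-- **The verdict shape «no closing at main order»**, currency by currency, every conditional input DISPLAYED: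
T-true `¬ (C₂₃₂C₂₃₃ < |𝔡+𝔡′|²)` | profile-level T-true `¬ (𝔅(g)𝔅(f) < ‖P(g,f)‖²)` | for EVERY `X`-world with the
E*-slot `InvisibleOverhang θ X` (bare `Prop`, kind (c); its negation = an E*-len⁺(X)-strength input):
`¬ (twoPieceMainTerm θ X u u′ v v′ s < 0)` | for all large `D`, all real primitive `χ (mod D)`, under the
(A)-world hypothesis `Re ρ = ½` on the sampled zeros (kind (b)): no main-order length gain,
`¬ (P^{−ε/8}(discMeanAbs(⌈P^{1+ε}⌉) + discWeight) < |discMean(⌈P^{1+δ}⌉) − discMean(⌈P^{1+ε}⌉)|)`.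
[cite: Zhang2022LandauSiegel, §2 (2.16)–(2.20), (2.32)–(2.33); §7 (7.2) p.44] -/
def NoMainOrderClosing : DesignPlus → Prop
  | .inR θ => ¬ (C232S θ * C233T θ < ‖dSumS θ‖ ^ 2)
  | .hOne g g' f f' => ¬ (mainTermForm g g' * mainTermForm f f' < ‖mainTermFormPolar g g' f f'‖ ^ 2)
  | .twoPiece θ u u' v v' s =>
      ∀ X : PairFunctional, InvisibleOverhang θ X → ¬ (twoPieceMainTerm θ X u u' v v' s < 0)
  | .farPiece c' δ ε g =>
      Skeleton.ForAllLarge fun D _ χ =>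
        (∀ i ∈ Skeleton.idx χ, (i.2).re = 1 / 2) →
          ¬ (Skeleton.bigP D ^ (-(ε / 8)) *
                (discMeanAbs c' χ g ⌈Skeleton.bigP D ^ (1 + ε)⌉₊ + discWeight c' χ) <
              |discMean c' χ g ⌈Skeleton.bigP D ^ (1 + δ)⌉₊ - discMean c' χ g ⌈Skeleton.bigP D ^ (1 + ε)⌉₊|)

/-! ### The theorem -/

/-- **NOT-REPAIRABLE-IN-CLASS `R⁺`.** For every design of class `R⁺` the main-order closing fails in its
currency: on `R` by `Repair.not_repairable_true_need` (p428635); on `R̄` by Cauchy–Schwarz for `𝔅`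
(`not_trueNeed_of_isH1`); on smooth two-piece designs of any length `θ ≥ 1`, in every `X`-world carrying the
displayed E*-slot `InvisibleOverhang θ X`, by `KnifeEdge.null_of_invisible` (p442741); on smooth profiles of
any length `P^{1+δ}` in the discrete-mean currency, under the displayed (A)-hypothesis `Re ρ = ½`, by
`KnifeEdgeDiscMeanFlat.discMeanFlat` (p446527 ← `tailInvisible` p446031). A statement about the method's
main terms over the class as architected; nothing about Theorems 1–2 or about zeros.
[cite: Zhang2022LandauSiegel, §2 Props. 2.2, 2.4–2.6, (2.32)–(2.33); §7 (7.2) p.44] -/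
theorem not_repairable_in_Rplus : ∀ d : DesignPlus, InRplus d → NoMainOrderClosing d
  | .inR θ, h => not_repairable_true_need θ h
  | .hOne _ _ _ _, h => not_trueNeed_of_isH1 h.1 h.2
  | .twoPiece _ u u' v v' s, h => fun _ hX => not_lt.2 (null_of_invisible hX u u' v v' s h.2.1 h.2.2)
  | .farPiece c' _ _ g, h =>
      (KnifeEdgeDiscMeanFlat.discMeanFlat c' h.1 h.2.1).mono fun _ _ _ _ _ hflat hA =>
        not_lt.2 (hflat hA g h.2.2.1 h.2.2.2)

/-! ### `R ⊆ R⁺` literally, and the unbundled forms (every hypothesis a binder) -/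

/-- Every class-`R` design is an `R⁺` design (the embedding is the constructor `inR`).
[cite: Zhang2022LandauSiegel, §2 (2.32)–(2.33)] -/
theorem inRplus_of_admissible (θ : Theta) (h : AdmissibleTheta θ) : InRplus (.inR θ) := h

/-- On `R` the theorem is `Repair.not_repairable_true_need` verbatim (same currency).
[cite: Zhang2022LandauSiegel, §2 (2.32)–(2.33)] -/
theorem not_repairable_in_Rplus_inR (θ : Theta) (h : AdmissibleTheta θ) :
    ¬ (C232S θ * C233T θ < ‖dSumS θ‖ ^ 2) :=
  not_repairable_in_Rplus (.inR θ) h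

/-- On `R̄`: no pair of `H¹` profiles satisfies the joint main-order criterion.
[cite: Zhang2022LandauSiegel, §2 (2.18), (2.32)–(2.33)] -/
theorem not_repairable_in_Rplus_hOne {g g' f f' : ℝ → ℂ} (hg : IsH1OnUnitInterval g g')
    (hf : IsH1OnUnitInterval f f') :
    ¬ (mainTermForm g g' * mainTermForm f f' < ‖mainTermFormPolar g g' f f'‖ ^ 2) :=
  not_repairable_in_Rplus (.hOne g g' f f') ⟨hg, hf⟩

/-- On smooth two-piece designs of any length `θ ≥ 1`: in every `X`-world with invisible overhang (displayed
E*-slot) the main-order constant of `s·u ⊕ v` is not negative. [cite: Zhang2022LandauSiegel, §7 (7.2) p.44] -/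
theorem not_repairable_in_Rplus_twoPiece {θ : ℝ} {u u' v v' : ℝ → ℂ} (hθ : 1 ≤ θ) (hu : InClassPiece u u')
    (hv : OverhangPiece θ v v') (X : PairFunctional) (hX : InvisibleOverhang θ X) (s : ℂ) :
    ¬ (twoPieceMainTerm θ X u u' v v' s < 0) :=
  not_repairable_in_Rplus (.twoPiece θ u u' v v' s) ⟨hθ, hu, hv⟩ X hX

/-- … hence no `X`-world with invisible overhang lets ANY smooth two-piece design close by positivity
(`KnifeEdge.not_closes_of_invisible`, p442741); the coupling it completes is the proved rank-one tail coupling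
`KnifeEdge.rankOneTailCoupling_holds`. [cite: Zhang2022LandauSiegel, §7 (7.2) p.44, (8.11)–(8.12)] -/
theorem not_closesByPositivity_in_Rplus {θ : ℝ} (hθ : 1 ≤ θ) (X : PairFunctional)
    (hX : InvisibleOverhang θ X) : RankOneTailCoupling θ ∧ ¬ ClosesByPositivity θ X :=
  ⟨rankOneTailCoupling_holds hθ, fun ⟨_, _, _, _, s, hu, hv, hlt⟩ =>
    not_repairable_in_Rplus_twoPiece hθ hu hv X hX s hlt⟩

/-- On smooth profiles of any length, discrete-mean currency, (A)-hypothesis displayed: no main-order gain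
from pushing the length past `P^{1+ε}`. [cite: Zhang2022LandauSiegel, §2 (2.16)–(2.20); §8 Lemma 8.1] -/
theorem not_repairable_in_Rplus_farPiece (c' : ℝ) {δ ε : ℝ} {g : ℝ → ℂ} (hε : 0 < ε) (hεδ : ε < δ)
    (hg : LipschitzWith 1 g) (hg1 : ∀ z, ‖g z‖ ≤ 1) :
    Skeleton.ForAllLarge fun D _ χ =>
      (∀ i ∈ Skeleton.idx χ, (i.2).re = 1 / 2) →
        ¬ (Skeleton.bigP D ^ (-(ε / 8)) *
              (discMeanAbs c' χ g ⌈Skeleton.bigP D ^ (1 + ε)⌉₊ + discWeight c' χ) <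
            |discMean c' χ g ⌈Skeleton.bigP D ^ (1 + δ)⌉₊ - discMean c' χ g ⌈Skeleton.bigP D ^ (1 + ε)⌉₊|) :=
  not_repairable_in_Rplus (.farPiece c' δ ε g) ⟨hε, hεδ, hg, hg1⟩

/-! ### Non-vacuity of the class (the charter's named members) -/

/-- The printed design `θ₀` is in `R⁺`. [cite: Zhang2022LandauSiegel, §2 p.10–11] -/
theorem inRplus_theta0 : InRplus (.inR theta0) := admissible_theta0

/-- The `ι`-free family `θ_ι` is in `R⁺`. [cite: Zhang2022LandauSiegel, §2 p.10–11] -/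
theorem inRplus_thetaIota (w2 w3 w4 : ℂ) : InRplus (.inR (thetaIota w2 w3 w4)) := admissible_thetaIota w2 w3 w4

/-- The two-piece witness `g⋆ ⊕ φ_θ` (kernel mode + cubic overhang) is in `R⁺` for every `θ ≥ 1` and every
weight `s`. [cite: Zhang2022LandauSiegel, §7 (7.2) p.44] -/
theorem inRplus_gStar_phiT {θ : ℝ} (hθ : 1 ≤ θ) (s : ℂ) :
    InRplus (.twoPiece θ gStar gStar' (phiT θ) (phiT' θ) s) :=
  ⟨hθ, inClassPiece_gStar, overhangPiece_phiT hθ⟩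

/-- … in particular at `θ = 21/20` and at `θ = 5/2`. [cite: Zhang2022LandauSiegel, §7 (7.2) p.44] -/
theorem inRplus_gStar_phiT_examples (s : ℂ) :
    InRplus (.twoPiece (21 / 20) gStar gStar' (phiT (21 / 20)) (phiT' (21 / 20)) s) ∧
      InRplus (.twoPiece (5 / 2) gStar gStar' (phiT (5 / 2)) (phiT' (5 / 2)) s) :=
  ⟨inRplus_gStar_phiT (by norm_num) s, inRplus_gStar_phiT (by norm_num) s⟩

/-- The `R̄`-presentation is inhabited (`g⋆` against itself). [cite: Zhang2022LandauSiegel, §2 (2.18)] -/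
theorem inRplus_hOne_gStar : InRplus (.hOne gStar gStar' gStar gStar') :=
  ⟨inClassPiece_gStar.kinked.isH1, inClassPiece_gStar.kinked.isH1⟩

/-- The flat profile `g ≡ 1` of any length `P^{1+δ}` is in `R⁺` (discrete-mean presentation).
[cite: Zhang2022LandauSiegel, §7 (7.2) p.44] -/
theorem inRplus_flatProfile (c' : ℝ) {δ ε : ℝ} (hε : 0 < ε) (hεδ : ε < δ) :
    InRplus (.farPiece c' δ ε fun _ => 1) :=
  ⟨hε, hεδ, (LipschitzWith.const (1 : ℂ)).weaken zero_le_one, fun _ => by simp⟩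

/-! ### Extension protocol: families, classes, `R⁺` as a list -/

/-- One currency of the record: a design type, its class predicate, its verdict shape (every conditional input
displayed inside `Verdict`, never inside `InClass`). [cite: Zhang2022LandauSiegel, §2 (2.32)–(2.33)] -/
structure DesignFamily : Type 1 where
  /-- the designs -/
  Design : Type
  /-- class membership -/
  InClass : Design → Prop
  /-- the verdict «no closing at main order» in the family's currency -/
  Verdict : Design → Prop

/-- A family is decided when every member satisfies the verdict. [cite: Zhang2022LandauSiegel, §2 (2.32)–(2.33)] -/
def DesignFamily.Decided (F : DesignFamily) : Prop := ∀ d, F.InClass d → F.Verdict d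

/-- A class (a list of families) is decided when each family is. [cite: Zhang2022LandauSiegel, §2 (2.32)–(2.33)] -/
def ClassDecided (L : List DesignFamily) : Prop := ∀ F ∈ L, F.Decided

/-- the empty class is decided (bookkeeping of the class of record). [cite: Zhang2022LandauSiegel, §2 (2.32)–(2.33)] -/
theorem classDecided_nil : ClassDecided [] := fun _ h => nomatch h

/-- `cons`: decide the new family, keep the rest (bookkeeping of the class of record).
[cite: Zhang2022LandauSiegel, §2 (2.32)–(2.33)] -/
theorem classDecided_cons {F : DesignFamily} {L : List DesignFamily} (hF : F.Decided) (hL : ClassDecided L) :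
    ClassDecided (F :: L) := fun G hG => by
  rcases List.mem_cons.1 hG with rfl | h
  · exact hF
  · exact hL G h

/-- `append`: an extension `L ++ L′` is decided iff both parts are (bookkeeping of the class of record).
[cite: Zhang2022LandauSiegel, §2 (2.32)–(2.33)] -/
theorem classDecided_append {L L' : List DesignFamily} :
    ClassDecided (L ++ L') ↔ ClassDecided L ∧ ClassDecided L' :=
  ⟨fun h => ⟨fun F hF => h F (List.mem_append.2 (Or.inl hF)), fun F hF => h F (List.mem_append.2 (Or.inr hF))⟩,
    fun h F hF => (List.mem_append.1 hF).elim (h.1 F) (h.2 F)⟩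

/-- family `R` (T-true currency). [cite: Zhang2022LandauSiegel, §2 (2.32)–(2.33)] -/
def familyR : DesignFamily where
  Design := Theta
  InClass := AdmissibleTheta
  Verdict θ := ¬ (C232S θ * C233T θ < ‖dSumS θ‖ ^ 2)

/-- family `R̄` (profile-level T-true currency). [cite: Zhang2022LandauSiegel, §2 (2.18), (2.32)–(2.33)] -/
def familyH1 : DesignFamily where
  Design := (ℝ → ℂ) × (ℝ → ℂ) × (ℝ → ℂ) × (ℝ → ℂ)
  InClass p := IsH1OnUnitInterval p.1 p.2.1 ∧ IsH1OnUnitInterval p.2.2.1 p.2.2.2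
  Verdict p := ¬ (mainTermForm p.1 p.2.1 * mainTermForm p.2.2.1 p.2.2.2 <
    ‖mainTermFormPolar p.1 p.2.1 p.2.2.1 p.2.2.2‖ ^ 2)

/-- family «smooth two-piece, any length, `X`-world currency» (E*-slot displayed in the verdict).
[cite: Zhang2022LandauSiegel, §7 (7.2) p.44] -/
def familyTwoPiece : DesignFamily where
  Design := ℝ × (ℝ → ℂ) × (ℝ → ℂ) × (ℝ → ℂ) × (ℝ → ℂ) × ℂ
  InClass p := 1 ≤ p.1 ∧ InClassPiece p.2.1 p.2.2.1 ∧ OverhangPiece p.1 p.2.2.2.1 p.2.2.2.2.1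
  Verdict p := ∀ X : PairFunctional, InvisibleOverhang p.1 X →
    ¬ (twoPieceMainTerm p.1 X p.2.1 p.2.2.1 p.2.2.2.1 p.2.2.2.2.1 p.2.2.2.2.2 < 0)

/-- family «smooth profile, any length, discrete-mean currency» ((A)-hypothesis displayed in the verdict).
[cite: Zhang2022LandauSiegel, §2 (2.16)–(2.20); §8 Lemma 8.1] -/
def familyFarPiece : DesignFamily where
  Design := ℝ × ℝ × ℝ × (ℝ → ℂ)
  InClass p := 0 < p.2.2.1 ∧ p.2.2.1 < p.2.1 ∧ LipschitzWith 1 p.2.2.2 ∧ ∀ z, ‖p.2.2.2 z‖ ≤ 1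
  Verdict p := Skeleton.ForAllLarge fun D _ χ =>
    (∀ i ∈ Skeleton.idx χ, (i.2).re = 1 / 2) →
      ¬ (Skeleton.bigP D ^ (-(p.2.2.1 / 8)) *
            (discMeanAbs p.1 χ p.2.2.2 ⌈Skeleton.bigP D ^ (1 + p.2.2.1)⌉₊ + discWeight p.1 χ) <
          |discMean p.1 χ p.2.2.2 ⌈Skeleton.bigP D ^ (1 + p.2.1)⌉₊ -
            discMean p.1 χ p.2.2.2 ⌈Skeleton.bigP D ^ (1 + p.2.2.1)⌉₊|)

/-- **The class `R⁺` as a list of families.** [cite: Zhang2022LandauSiegel, §2 (2.32)–(2.33); §7 (7.2) p.44] -/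
def Rplus : List DesignFamily := [familyR, familyH1, familyTwoPiece, familyFarPiece]

/-- **`R⁺` is decided** (`not_repairable_in_Rplus`, re-packaged family by family); an extension `R⁺⁺ = Rplus ++ [F]`
needs exactly `F.Decided` (`classDecided_append`). [cite: Zhang2022LandauSiegel, §2 (2.32)–(2.33); §7 (7.2) p.44] -/
theorem rplus_decided : ClassDecided Rplus :=
  classDecided_cons (fun θ h => not_repairable_in_Rplus (.inR θ) h) <|
    classDecided_cons (fun p h => not_repairable_in_Rplus (.hOne p.1 p.2.1 p.2.2.1 p.2.2.2) h) <|
      classDecided_cons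
          (fun p h => not_repairable_in_Rplus (.twoPiece p.1 p.2.1 p.2.2.1 p.2.2.2.1 p.2.2.2.2.1 p.2.2.2.2.2) h) <|
        classDecided_cons (fun p h => not_repairable_in_Rplus (.farPiece p.1 p.2.1 p.2.2.1 p.2.2.2) h)
          classDecided_nil

/-- The extension lemma in the form the next files use: `ClassDecided (Rplus ++ [F])` from `F.Decided`.
[cite: Zhang2022LandauSiegel, §2 (2.32)–(2.33)] -/
theorem rplus_extend {F : DesignFamily} (hF : F.Decided) : ClassDecided (Rplus ++ [F]) :=
  classDecided_append.2 ⟨rplus_decided, classDecided_cons hF classDecided_nil⟩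

end Repair

end Literature.NumberTheory.LFunctions.Zhang2022
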